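import Mathlib
import Literature.Analysis.FluidPDE.NormalisedPressureSmooth
import Summits.NavierStokesRegularity.NavierStokesRegularity.Theorems.SymmetryModuliCountFarPastLedgerSliceSource
import Summits.NavierStokesRegularity.NavierStokesRegularity.Theorems.SymmetryModuliCountFarPastLedgerSliceFar
import Summits.NavierStokesRegularity.NavierStokesRegularity.Theorems.SymmetryModuliCountFarPastLedgerSliceDecompTools
import HarnessLib

/-!
# Slice pressure, consistency of the near/far splitting (crux `FarPastLedger`, line `uloc-gronwall-transplant`)

Helper file for the lead's stub `stub_fplSlicePressure` of crux stmt-NavierStokesRegularity-14060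
(`SymmetryModuliCount.FarPastLedger`). For a smooth bounded field `w` and two partitions
`ηᵢ² + ζᵢ² = 1` adapted to balls `B(cᵢ, Rᵢ)` (`ηᵢ = 0` off `B(cᵢ,4Rᵢ)`, `ζᵢ = 0` on `B(cᵢ,3Rᵢ)`),
the "gradient of the full pressure"

  `D(p̃[ηᵢw])(x) - ∫ D³Γ∞ᵢ(x-y)(·, ζᵢw, ζᵢw) dy`     (`Γ∞ᵢ = newtonFar (Rᵢ/2) Rᵢ`)

does not depend on `i` at points `x ∈ B(c₀,2R₀) ∩ B(c₁,2R₁)` (`fpl_slice_consistency`).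
Proof: with a common truncation `g_ρ` (`= 1` on both near supports), the tensors
`η₀² + g_ρ²ζ₀²` and `η₁² + g_ρ²ζ₁²` coincide, so `p̃[η₀w] + p̃[g_ρζ₀w] = p̃[η₁w] + p̃[g_ρζ₁w]`
(`fpl_normalisedPressure_add_eq_add`); differentiate at `x` and let `ρ → ∞`
(`D(p̃[g_ρζᵢw])(x) → -∫ D³Γ∞ᵢ(x-y)(·, ζᵢw, ζᵢw)`).
-/

noncomputable section

open MeasureTheory Set Filter Metric Topology
open scoped ContDiff

set_option linter.dupNamespace false -- nested layout Summit.<S>.<Sub>, Sub = S (D-0017)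

namespace Summit.NavierStokesRegularity.NavierStokesRegularity.Theorems

open Literature.Analysis.FluidPDE

-- nested operator types `E →L[ℝ] E →L[ℝ] E →L[ℝ] ℝ`
set_option maxSynthPendingDepth 3

/-- The far gradient of a truncated far field converges: for `ζ w` vanishing on `B(c, 3R)`,
`R ≥ 1`, `x ∈ B(c, 2R)`, and the truncations `g_ρ` about any centre `x₀`,
`D(p̃[g_ρ ζ w])(x) → -∫ D³Γ∞(x-y)(·, ζw, ζw) dy` as `ρ → ∞`. -/
theorem fpl_tendsto_fderiv_truncated {w : EuclideanSpace ℝ (Fin 3) → EuclideanSpace ℝ (Fin 3)}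
    (hw : ContDiff ℝ ∞ w) {M : ℝ} (hM : ∀ y, ‖w y‖ ≤ M) {c : EuclideanSpace ℝ (Fin 3)} {R : ℝ}
    (hR : 1 ≤ R) {ζ : EuclideanSpace ℝ (Fin 3) → ℝ} (hζ : ContDiff ℝ ∞ ζ) (hζ1 : ∀ y, |ζ y| ≤ 1)
    (hζ0 : ∀ y ∈ ball c (3 * R), ζ y = 0) (x₀ : EuclideanSpace ℝ (Fin 3))
    {x : EuclideanSpace ℝ (Fin 3)} (hx : x ∈ ball c (2 * R)) :
    Tendsto (fun ρ : ℝ => fderiv ℝ (normalisedPressure fun y =>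
        (((⟨1, 2, zero_lt_one, one_lt_two⟩ : ContDiffBump (0 : EuclideanSpace ℝ (Fin 3))) :
          EuclideanSpace ℝ (Fin 3) → ℝ) (ρ⁻¹ • (y - x₀)) * ζ y) • w y) x) atTop
      (𝓝 (-∫ y, (evalDiag (ζ y • w y)).comp
        (fderiv ℝ (fderiv ℝ (fderiv ℝ (newtonFar (R / 2) R))) (x - y)))) := by
  obtain ⟨C_K, -, hCK⟩ := fpl_exists_kernel_bound
  set θ : EuclideanSpace ℝ (Fin 3) → ℝ :=
    ((⟨1, 2, zero_lt_one, one_lt_two⟩ : ContDiffBump (0 : EuclideanSpace ℝ (Fin 3))) :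
      EuclideanSpace ℝ (Fin 3) → ℝ) with hθ
  set g : ℝ → EuclideanSpace ℝ (Fin 3) → ℝ := fun ρ y => θ (ρ⁻¹ • (y - x₀)) with hg
  have hgd : ∀ ρ, ContDiff ℝ ∞ (g ρ) := fun ρ => fpl_trunc_contDiff x₀
  have hg1 : ∀ ρ y, |g ρ y| ≤ 1 := fun ρ y => fpl_trunc_abs_le_one x₀ ρ y
  set u : EuclideanSpace ℝ (Fin 3) → EuclideanSpace ℝ (Fin 3) := fun y => ζ y • w y with hu
  have huc : Continuous u := hζ.continuous.smul hw.continuous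
  have huM : ∀ y, ‖u y‖ ≤ M := fun y => by
    simp only [hu, norm_smul, Real.norm_eq_abs]
    calc |ζ y| * ‖w y‖ ≤ 1 * M := mul_le_mul (hζ1 y) (hM y) (norm_nonneg _) zero_le_one
      _ = M := one_mul M
  have hu0 : ∀ y ∈ ball c (3 * R), u y = 0 := fun y hy => by simp [hu, hζ0 y hy]
  -- the truncated fields
  set v : ℝ → EuclideanSpace ℝ (Fin 3) → EuclideanSpace ℝ (Fin 3) := fun ρ y => (g ρ y * ζ y) • w y
    with hvdef
  have hv_eq : ∀ ρ y, v ρ y = g ρ y • u y := fun ρ y => by simp only [hvdef, hu, smul_smul]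
  have hvd : ∀ ρ, ContDiff ℝ ∞ (v ρ) := fun ρ => ((hgd ρ).mul hζ).smul hw
  have hvc : ∀ ρ, 0 < ρ → HasCompactSupport (v ρ) := fun ρ hρ => by
    refine HasCompactSupport.intro (isCompact_closedBall x₀ (2 * ρ)) fun y hy => ?_
    have hy' : y ∉ ball x₀ (2 * ρ) := fun h => hy (ball_subset_closedBall h)
    have : g ρ y = 0 := fpl_trunc_eq_zero hρ hy'
    simp [hvdef, this]
  have hv0 : ∀ ρ, ∀ y ∈ ball c (3 * R), v ρ y = 0 := fun ρ y hy => by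
    rw [hv_eq, hu0 y hy, smul_zero]
  -- the derivative formula for `ρ > 0`
  have hD : ∀ᶠ ρ : ℝ in atTop, fderiv ℝ (normalisedPressure (v ρ)) x =
      -∫ y, (evalDiag (g ρ y • u y)).comp
        (fderiv ℝ (fderiv ℝ (fderiv ℝ (newtonFar (R / 2) R))) (x - y)) := by
    filter_upwards [eventually_gt_atTop (0 : ℝ)] with ρ hρ
    rw [(fpl_hasFDerivAt_normalisedPressure_far hR (hvd ρ) (hvc ρ hρ) (hv0 ρ) hx).fderiv]
    congr 1
    refine integral_congr_ae (Eventually.of_forall fun y => ?_)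
    simp only [hv_eq]
  have key := (fpl_tendsto_farGradient hCK hR huc huM hu0 hx (c := g)
    (fun ρ => (hgd ρ).continuous) hg1 (fun y => fpl_trunc_eventually_one x₀ y)).neg
  exact (tendsto_congr' hD).2 key

/-- **CONSISTENCY OF THE SPLITTING.** For a smooth bounded field `w` and two adapted partitions
(module docstring), the covector `D(p̃[ηᵢw])(x) - ∫ D³Γ∞ᵢ(x-y)(·, ζᵢw, ζᵢw) dy` is the same for
`i = 0, 1` at every `x ∈ B(c₀, 2R₀) ∩ B(c₁, 2R₁)`. -/
theorem fpl_slice_consistency {w : EuclideanSpace ℝ (Fin 3) → EuclideanSpace ℝ (Fin 3)}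
    (hw : ContDiff ℝ ∞ w) {M : ℝ} (hM : ∀ y, ‖w y‖ ≤ M)
    {c₀ c₁ : EuclideanSpace ℝ (Fin 3)} {R₀ R₁ : ℝ} (hR₀ : 1 ≤ R₀) (hR₁ : 1 ≤ R₁)
    {η₀ ζ₀ η₁ ζ₁ : EuclideanSpace ℝ (Fin 3) → ℝ} (hη₀ : ContDiff ℝ ∞ η₀) (hζ₀ : ContDiff ℝ ∞ ζ₀)
    (hη₁ : ContDiff ℝ ∞ η₁) (hζ₁ : ContDiff ℝ ∞ ζ₁)
    (h1₀ : ∀ y, η₀ y ^ 2 + ζ₀ y ^ 2 = 1) (h1₁ : ∀ y, η₁ y ^ 2 + ζ₁ y ^ 2 = 1)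
    (hη₀0 : ∀ y ∉ ball c₀ (4 * R₀), η₀ y = 0) (hζ₀0 : ∀ y ∈ ball c₀ (3 * R₀), ζ₀ y = 0)
    (hη₁0 : ∀ y ∉ ball c₁ (4 * R₁), η₁ y = 0) (hζ₁0 : ∀ y ∈ ball c₁ (3 * R₁), ζ₁ y = 0)
    {x : EuclideanSpace ℝ (Fin 3)} (hx₀ : x ∈ ball c₀ (2 * R₀)) (hx₁ : x ∈ ball c₁ (2 * R₁)) :
    fderiv ℝ (normalisedPressure fun y => η₀ y • w y) x -
        ∫ y, (evalDiag (ζ₀ y • w y)).comp (fderiv ℝ (fderiv ℝ (fderiv ℝ (newtonFar (R₀ / 2) R₀))) (x - y)) =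
      fderiv ℝ (normalisedPressure fun y => η₁ y • w y) x -
        ∫ y, (evalDiag (ζ₁ y • w y)).comp (fderiv ℝ (fderiv ℝ (fderiv ℝ (newtonFar (R₁ / 2) R₁))) (x - y)) := by
  -- `|ζᵢ| ≤ 1`
  have hζ₀1 : ∀ y, |ζ₀ y| ≤ 1 := fun y => by
    have := h1₀ y; nlinarith [sq_nonneg (η₀ y), sq_abs (ζ₀ y)]
  have hζ₁1 : ∀ y, |ζ₁ y| ≤ 1 := fun y => by
    have := h1₁ y; nlinarith [sq_nonneg (η₁ y), sq_abs (ζ₁ y)]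
  -- common truncation about `c₀`
  set θ : EuclideanSpace ℝ (Fin 3) → ℝ :=
    ((⟨1, 2, zero_lt_one, one_lt_two⟩ : ContDiffBump (0 : EuclideanSpace ℝ (Fin 3))) :
      EuclideanSpace ℝ (Fin 3) → ℝ) with hθ
  set g : ℝ → EuclideanSpace ℝ (Fin 3) → ℝ := fun ρ y => θ (ρ⁻¹ • (y - c₀)) with hg
  have hgd : ∀ ρ, ContDiff ℝ ∞ (g ρ) := fun ρ => fpl_trunc_contDiff c₀
  -- near fields and truncated far fields
  set N₀ : EuclideanSpace ℝ (Fin 3) → ℝ := normalisedPressure fun y => η₀ y • w y with hN₀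
  set N₁ : EuclideanSpace ℝ (Fin 3) → ℝ := normalisedPressure fun y => η₁ y • w y with hN₁
  set Q₀ : ℝ → EuclideanSpace ℝ (Fin 3) → ℝ := fun ρ => normalisedPressure fun y => (g ρ y * ζ₀ y) • w y
    with hQ₀
  set Q₁ : ℝ → EuclideanSpace ℝ (Fin 3) → ℝ := fun ρ => normalisedPressure fun y => (g ρ y * ζ₁ y) • w y
    with hQ₁
  have hn₀d : ContDiff ℝ ∞ fun y => η₀ y • w y := hη₀.smul hw
  have hn₁d : ContDiff ℝ ∞ fun y => η₁ y • w y := hη₁.smul hw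
  have hcs : ∀ {η : EuclideanSpace ℝ (Fin 3) → ℝ} {c : EuclideanSpace ℝ (Fin 3)} {r : ℝ},
      (∀ y ∉ ball c r, η y = 0) → HasCompactSupport fun y => η y • w y := by
    intro η c r h0
    refine HasCompactSupport.intro (isCompact_closedBall c r) fun y hy => ?_
    have hy' : y ∉ ball c r := fun h => hy (ball_subset_closedBall h)
    simp [h0 y hy']
  have hn₀c : HasCompactSupport fun y => η₀ y • w y := hcs hη₀0
  have hn₁c : HasCompactSupport fun y => η₁ y • w y := hcs hη₁0
  have hq₀d : ∀ ρ, ContDiff ℝ ∞ fun y => (g ρ y * ζ₀ y) • w y := fun ρ => ((hgd ρ).mul hζ₀).smul hw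
  have hq₁d : ∀ ρ, ContDiff ℝ ∞ fun y => (g ρ y * ζ₁ y) • w y := fun ρ => ((hgd ρ).mul hζ₁).smul hw
  have hqc : ∀ {ζ : EuclideanSpace ℝ (Fin 3) → ℝ} (ρ : ℝ), 0 < ρ →
      HasCompactSupport fun y => (g ρ y * ζ y) • w y := by
    intro ζ ρ hρ
    refine HasCompactSupport.intro (isCompact_closedBall c₀ (2 * ρ)) fun y hy => ?_
    have hy' : y ∉ ball c₀ (2 * ρ) := fun h => hy (ball_subset_closedBall h)
    have : g ρ y = 0 := fpl_trunc_eq_zero hρ hy'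
    simp [this]
  -- for `ρ` large the tensors agree: `η₀² + (gζ₀)² = η₁² + (gζ₁)²`
  have htensor : ∀ ρ, 4 * R₀ ≤ ρ → ‖c₁ - c₀‖ + 4 * R₁ ≤ ρ →
      ∀ y, η₀ y ^ 2 + (g ρ y * ζ₀ y) ^ 2 = η₁ y ^ 2 + (g ρ y * ζ₁ y) ^ 2 := by
    intro ρ hρ₀ hρ₁ y
    have hρ : 0 < ρ := by linarith
    by_cases hy : y ∈ closedBall c₀ ρ
    · have : g ρ y = 1 := fpl_trunc_eq_one hρ hy
      rw [this, one_mul, one_mul, h1₀ y, h1₁ y]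
    · rw [mem_closedBall, not_le, dist_eq_norm] at hy
      have hy₀ : y ∉ ball c₀ (4 * R₀) := by
        rw [mem_ball, dist_eq_norm, not_lt]; linarith
      have hy₁ : y ∉ ball c₁ (4 * R₁) := by
        rw [mem_ball, dist_eq_norm, not_lt]
        have : ‖y - c₀‖ ≤ ‖y - c₁‖ + ‖c₁ - c₀‖ := norm_sub_le_norm_sub_add_norm_sub _ _ _
        linarith
      have e₀ : ζ₀ y ^ 2 = 1 := by have := h1₀ y; rw [hη₀0 y hy₀] at this; linarith
      have e₁ : ζ₁ y ^ 2 = 1 := by have := h1₁ y; rw [hη₁0 y hy₁] at this; linarith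
      rw [hη₀0 y hy₀, hη₁0 y hy₁, mul_pow, mul_pow, e₀, e₁]
  -- hence `N₀ + Q₀ ρ = N₁ + Q₁ ρ` and the derivatives at `x` agree
  have hDsum : ∀ᶠ ρ : ℝ in atTop, fderiv ℝ N₀ x + fderiv ℝ (Q₀ ρ) x = fderiv ℝ N₁ x + fderiv ℝ (Q₁ ρ) x := by
    filter_upwards [eventually_ge_atTop (4 * R₀), eventually_ge_atTop (‖c₁ - c₀‖ + 4 * R₁)] with ρ hρ₀ hρ₁
    have hρ : 0 < ρ := by linarith
    have hfun : (fun z => N₀ z + Q₀ ρ z) = fun z => N₁ z + Q₁ ρ z := by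
      funext z
      exact fpl_normalisedPressure_add_eq_add (v := w) hn₀d (hq₀d ρ) hn₁d (hq₁d ρ) hn₀c (hqc ρ hρ)
        hn₁c (hqc ρ hρ) (htensor ρ hρ₀ hρ₁) z
    have hdN₀ : DifferentiableAt ℝ N₀ x :=
      ((contDiff_normalisedPressure_of_contDiff_infty hn₀d hn₀c).differentiable (by simp)) x
    have hdN₁ : DifferentiableAt ℝ N₁ x :=
      ((contDiff_normalisedPressure_of_contDiff_infty hn₁d hn₁c).differentiable (by simp)) x
    have hdQ₀ : DifferentiableAt ℝ (Q₀ ρ) x :=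
      ((contDiff_normalisedPressure_of_contDiff_infty (hq₀d ρ) (hqc ρ hρ)).differentiable (by simp)) x
    have hdQ₁ : DifferentiableAt ℝ (Q₁ ρ) x :=
      ((contDiff_normalisedPressure_of_contDiff_infty (hq₁d ρ) (hqc ρ hρ)).differentiable (by simp)) x
    have this : fderiv ℝ (fun z => N₀ z + Q₀ ρ z) x = fderiv ℝ (fun z => N₁ z + Q₁ ρ z) x := by
      rw [hfun]
    rwa [fderiv_fun_add hdN₀ hdQ₀, fderiv_fun_add hdN₁ hdQ₁] at this
  -- limits of the truncated far derivatives
  have hlim₀ := fpl_tendsto_fderiv_truncated hw hM hR₀ hζ₀ hζ₀1 hζ₀0 c₀ hx₀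
  have hlim₁ := fpl_tendsto_fderiv_truncated hw hM hR₁ hζ₁ hζ₁1 hζ₁0 c₀ hx₁
  -- `fderiv N₀ x - fderiv N₁ x = fderiv (Q₁ ρ) x - fderiv (Q₀ ρ) x → (-G₁) - (-G₀)`
  have hconst : Tendsto (fun ρ : ℝ => fderiv ℝ (Q₁ ρ) x - fderiv ℝ (Q₀ ρ) x) atTop
      (𝓝 (fderiv ℝ N₀ x - fderiv ℝ N₁ x)) := by
    refine (tendsto_congr' ?_).1 tendsto_const_nhds
    filter_upwards [hDsum] with ρ hρ
    rw [eq_sub_iff_add_eq, sub_add_eq_add_sub, sub_eq_iff_eq_add, hρ]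
    abel
  have hlim : Tendsto (fun ρ : ℝ => fderiv ℝ (Q₁ ρ) x - fderiv ℝ (Q₀ ρ) x) atTop
      (𝓝 ((-∫ y, (evalDiag (ζ₁ y • w y)).comp
          (fderiv ℝ (fderiv ℝ (fderiv ℝ (newtonFar (R₁ / 2) R₁))) (x - y))) -
        (-∫ y, (evalDiag (ζ₀ y • w y)).comp
          (fderiv ℝ (fderiv ℝ (fderiv ℝ (newtonFar (R₀ / 2) R₀))) (x - y))))) :=
    hlim₁.sub hlim₀
  have key := tendsto_nhds_unique hconst hlim
  rw [sub_eq_sub_iff_sub_eq_sub, key]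
  abel

/-- Registered form (sub-goal `fpl_sliceConsistency_main` of crux stmt-NavierStokesRegularity-14060):
consistency of the near/far splitting of the Riesz pressure of a bounded smooth field. -/
theorem fpl_sliceConsistency_main :
    ∀ (w : EuclideanSpace ℝ (Fin 3) → EuclideanSpace ℝ (Fin 3)), ContDiff ℝ (⊤ : ℕ∞) w →
    ∀ (M : ℝ), (∀ y, ‖w y‖ ≤ M) →
    ∀ (c₀ c₁ : EuclideanSpace ℝ (Fin 3)) (R₀ R₁ : ℝ), 1 ≤ R₀ → 1 ≤ R₁ →
    ∀ (η₀ ζ₀ η₁ ζ₁ : EuclideanSpace ℝ (Fin 3) → ℝ), ContDiff ℝ (⊤ : ℕ∞) η₀ → ContDiff ℝ (⊤ : ℕ∞) ζ₀ →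
    ContDiff ℝ (⊤ : ℕ∞) η₁ → ContDiff ℝ (⊤ : ℕ∞) ζ₁ →
    (∀ y, η₀ y ^ 2 + ζ₀ y ^ 2 = 1) → (∀ y, η₁ y ^ 2 + ζ₁ y ^ 2 = 1) →
    (∀ y ∉ Metric.ball c₀ (4 * R₀), η₀ y = 0) → (∀ y ∈ Metric.ball c₀ (3 * R₀), ζ₀ y = 0) →
    (∀ y ∉ Metric.ball c₁ (4 * R₁), η₁ y = 0) → (∀ y ∈ Metric.ball c₁ (3 * R₁), ζ₁ y = 0) →
    ∀ (x : EuclideanSpace ℝ (Fin 3)), x ∈ Metric.ball c₀ (2 * R₀) → x ∈ Metric.ball c₁ (2 * R₁) →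
    fderiv ℝ (Literature.Analysis.FluidPDE.normalisedPressure fun y => η₀ y • w y) x -
        ∫ y, (Literature.Analysis.FluidPDE.evalDiag (ζ₀ y • w y)).comp
          (fderiv ℝ (fderiv ℝ (fderiv ℝ (Literature.Analysis.FluidPDE.newtonFar (R₀ / 2) R₀))) (x - y)) =
      fderiv ℝ (Literature.Analysis.FluidPDE.normalisedPressure fun y => η₁ y • w y) x -
        ∫ y, (Literature.Analysis.FluidPDE.evalDiag (ζ₁ y • w y)).comp
          (fderiv ℝ (fderiv ℝ (fderiv ℝ (Literature.Analysis.FluidPDE.newtonFar (R₁ / 2) R₁))) (x - y)) :=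
  fun _ hw _ hM _ _ _ _ hR₀ hR₁ _ _ _ _ hη₀ hζ₀ hη₁ hζ₁ h1₀ h1₁ hη₀0 hζ₀0 hη₁0 hζ₁0 _ hx₀ hx₁ =>
    fpl_slice_consistency hw hM hR₀ hR₁ hη₀ hζ₀ hη₁ hζ₁ h1₀ h1₁ hη₀0 hζ₀0 hη₁0 hζ₁0 hx₀ hx₁

end Summit.NavierStokesRegularity.NavierStokesRegularity.Theorems

end
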